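import Literature.NumberTheory.GaloisRepresentations.HeckeLFunctionMeromorphicContinuationProofs
import Literature.NumberTheory.Automorphic.GodementJacquetRankOneEntire
import HarnessLib

/-!
# Entire continuation of Hecke `L`-functions of characters which are not norm twists
# (Tate's Thm. 4.4.1, entire case): the discharge

Topic `NumberTheory/GaloisRepresentations`; namespace `Literature.NumberTheory.GaloisRepresentations`.
Proof file (theorems only: no definition, no named fact, no instance, no `sorry`) discharging the
named fact `heckeLFunction_hasEntireContinuation_of_not_isNormTwist` of `HeckeCharacter.lean`:

> J. Tate, *Fourier analysis in number fields and Hecke's zeta-functions* (1950), in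
> Cassels–Fröhlich, *Algebraic Number Theory* (1967), Ch. XV, Thm. 4.4.1 (p. 342) with Lemma B of
> its proof: the zeta function `ζ(f, c)` is "regular" everywhere except at the quasi-characters
> `c = |·|^0`, `|·|^1`, the pole terms appearing only for `c` trivial on `J = 𝕀_K¹`; whence (§4.5)
> `L(s, χ)` is entire for every unitary Hecke character `χ` which is not a norm twist `‖·‖^{it}`
> (Hecke (1920); Neukirch, *Algebraic Number Theory*, VII Cor. (8.6)).

Like its sibling `HeckeLFunctionMeromorphicContinuationProofs` (the meromorphic case), the file
**assembles theorems already in the tree** along the route "Tate's theorem = Godement–Jacquet for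
`GL_1`":

1. `HeckeCharacter.hasEntireContinuation_heckeLFunction_of_map_posRealIdele` — for a unitary
   `θ ≠ 1` trivial on `ℝ_{>0}` (`Automorphic.posRealIdele`), the full `L(s, θ)` (the product over
   the places where `θ` is unramified, `heckeLFunction`) is entire: it is the partial `L^S(s, θ)` at
   `S = θ.ramifiedPlaces` (finite, `finite_ramifiedPlaces_holds`), entire by Hecke's theorem in the
   form `Automorphic.exists_entire_eq_partialHeckeL` (`GodementJacquetRankOneEntire`: the zeta
   integral of `GL_1` has polar coefficient `E = 0` when `∫ φ = 0`, Tate's Lemma B), after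
   reindexing `{v ∉ S} = {v : θ unramified at v}`;
2. `heckeLFunction_hasEntireContinuation_of_not_isNormTwist_holds` (**the named fact is a
   theorem**, for number fields `K : Type`): a unitary `χ` is `θ · ν` with `θ` unitary, trivial
   on `ℝ_{>0}`, and `ν = ‖·‖^z`, `re z = 0`
   (`HeckeCharacter.exists_mul_eq_and_map_posRealIdele_eq_one`); `χ` not a norm twist forces
   `θ ≠ 1`; and `L(s, χ) = L(s + z, θ)` (`HeckeCharacter.heckeLFunction_mul_eq_of_forall_apply_eq_cpow`;
   Tate, §4.4, `ζ(f, c|·|^s)`), a translate of an entire function by a purely imaginary `z`;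
3. `heckeLFunction_continuation_ne_zero_of_re_eq_one` — consequently **Hecke–Landau is
   unconditional**: for unitary `χ` not a norm twist, the entire continuation of `L(s, χ)` has no
   zero on the line `Re s = 1` (`HeckeCharacter.hasEntireContinuation_continuation_ne_zero_of_re_eq_one`,
   `HeckeLFunctionNonvanishingLineProofs`, fed with (2) for `χ` and `χ⁻¹`; Iwasawa (1964), Prop. 4.4).

## Universe

As for the meromorphic sibling: `HeckeCharacter.lean` declares the fact for `K : Type u`; the
automorphic formalism (`AdelicGroupData.gl 1 K`, `posRealIdele`, Godement–Jacquet) and every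
consumer of the fact in the tree (`PairLFunctionPolesGLOneTateProofs`, `…GLOneBoundaryProofs`,
`PairLFunctionMeromorphicContinuationNeConjProofs`, `HeckeLFunctionNonvanishing{,Line}Proofs`, …)
live at `K : Type`, and so does this discharge.

## References

* J. Tate, *Fourier analysis in number fields and Hecke's zeta-functions* (1950), in
  Cassels–Fröhlich (eds.), *Algebraic Number Theory* (1967), Ch. XV, Thm. 4.4.1 with Lemma B, §4.5.
  [TateThesis1967]
* K. Iwasawa, *Hecke's `L`-functions* (lectures, Princeton, 1964), SpringerBriefs (2019), Thm. 3.1,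
  Prop. 4.4. [Iwasawa2019]
* J. Neukirch, *Algebraic Number Theory* (1999), Ch. VII §8, Cor. (8.6). [NeukirchANT1999]
-/

noncomputable section

open MeasureTheory Measure NumberField IsDedekindDomain Filter Complex
open scoped NNReal Topology

namespace Literature.NumberTheory.GaloisRepresentations

namespace HeckeCharacter

open Literature.NumberTheory.Automorphic AdelicGroupData

variable {K : Type} [Field K] [NumberField K]

/-- **Hecke's theorem for the characters of `GL_1(K) ℝ_{>0} \ GL_1(𝔸_K)`, full `L`-function.**
For a unitary Hecke character `θ ≠ 1` of `K` trivial on `ℝ_{>0}` (`posRealIdele`), the Hecke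
`L`-function `L(s, θ) = ∏_{θ unramified at v} (1 - θ(ϖ_v) q_v^{-s})⁻¹` (`heckeLFunction θ`,
genuine value on `re s > 1`) extends to an entire function: `Automorphic.exists_entire_eq_partialHeckeL`
at the finite set `S = θ.ramifiedPlaces` (`finite_ramifiedPlaces_holds`; an auxiliary automorphic
measure of `GL_1`, `exists_isAutomorphicMeasure_gl_one`, realises `θ` in `L²`), the two products
being the same after reindexing `{v // v ∉ S} ≃ {v // θ.IsUnramifiedAt v}` (`Equiv.tprod_eq`).
Tate (1950), Thm. 4.4.1 (the case "`c` non-trivial on `J`", Lemma B); Iwasawa (1964), Thm. 3.1.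
[cite: TateThesis1967, Thm. 4.4.1] -/
theorem hasEntireContinuation_heckeLFunction_of_map_posRealIdele {θ : HeckeCharacter K}
    (hθ : θ.IsUnitary) (hθ₀ : ∀ t, θ (posRealIdele K t) = 1) (h1 : θ ≠ 1) :
    LFunction.HasEntireContinuation (heckeLFunction θ) := by
  obtain ⟨μ, hμ⟩ := exists_isAutomorphicMeasure_gl_one K
  have hS : θ.ramifiedPlaces.Finite := finite_ramifiedPlaces_holds θ
  have hur : ∀ v ∉ θ.ramifiedPlaces, θ.IsUnramifiedAt v := fun v hv => by
    simpa only [ramifiedPlaces, Set.mem_setOf_eq, not_not] using hv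
  obtain ⟨g, hg, hgL⟩ := exists_entire_eq_partialHeckeL μ θ hθ hθ₀ h1 hS hur
  refine ⟨g, hg, fun s hs => ?_⟩
  rw [hgL s hs, heckeLFunction]
  have e : ∀ v : HeightOneSpectrum (𝓞 K), v ∉ θ.ramifiedPlaces ↔ θ.IsUnramifiedAt v := fun v => by
    simp only [ramifiedPlaces, Set.mem_setOf_eq, not_not]
  exact Equiv.tprod_eq (Equiv.subtypeEquivRight e)
    (fun v : {v : HeightOneSpectrum (𝓞 K) // θ.IsUnramifiedAt v} =>
      (1 - θ.valueAtUniformizer v.1 * ((v.1.residueCard : ℂ) ^ (-s)))⁻¹)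

end HeckeCharacter

/-! ### The named fact -/

variable {K : Type} [Field K] [NumberField K]

open Literature.NumberTheory.Automorphic in
/-- **Tate's theorem, entire case: `L(s, χ)` is entire for a unitary Hecke character `χ` which is
not a norm twist** — the named fact `heckeLFunction_hasEntireContinuation_of_not_isNormTwist χ` of
`HeckeCharacter.lean` (Tate (1950), Thm. 4.4.1; Hecke (1920); Neukirch VII Cor. (8.6)) is a theorem
for every Hecke character `χ` of every number field `K : Type`. For unitary `χ = θ · ν`, `ν = ‖·‖^z`,
`re z = 0`, `θ` unitary and trivial on `ℝ_{>0}` (`HeckeCharacter.exists_mul_eq_and_map_posRealIdele_eq_one`):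
`χ` is not a norm twist, so `θ ≠ 1` (else `χ = ‖·‖^z`); `L(s, χ) = L(s + z, θ)`
(`HeckeCharacter.heckeLFunction_mul_eq_of_forall_apply_eq_cpow`; Tate, §4.4), and `L(·, θ)` is entire
(`HeckeCharacter.hasEntireContinuation_heckeLFunction_of_map_posRealIdele`), so the translate
`s ↦ g(s + z)` of its continuation is the required entire function (`re (s + z) = re s`).
[cite: TateThesis1967, Thm. 4.4.1] -/
theorem heckeLFunction_hasEntireContinuation_of_not_isNormTwist_holds (χ : HeckeCharacter K) :
    heckeLFunction_hasEntireContinuation_of_not_isNormTwist χ := by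
  intro hχ hnt
  obtain ⟨θ, ν, z, hθ, hθ₀, hz, hν, rfl⟩ :=
    HeckeCharacter.exists_mul_eq_and_map_posRealIdele_eq_one hχ
  -- `θ ≠ 1`, for `χ = 1 · ν = ‖·‖^z` would be a norm twist
  have h1 : θ ≠ 1 := by
    rintro rfl
    exact hnt ⟨z, fun x => by rw [one_mul]; exact_mod_cast hν x⟩
  obtain ⟨g, hg, hgL⟩ :=
    HeckeCharacter.hasEntireContinuation_heckeLFunction_of_map_posRealIdele hθ hθ₀ h1
  refine ⟨fun s => g (s + z), hg.comp (differentiable_id.add_const z), fun s hs => ?_⟩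
  show g (s + z) = heckeLFunction (θ * ν) s
  rw [HeckeCharacter.heckeLFunction_mul_eq_of_forall_apply_eq_cpow θ hν s, hgL (s + z)]
  rw [Complex.add_re, hz, add_zero]
  exact hs

/-- **Hecke–Landau, unconditionally: `L(1 + it, χ) ≠ 0`.** For a unitary Hecke character `χ` of
`K` which is not a norm twist and every `s₀` with `Re s₀ = 1`, the entire continuation of `L(s, χ)`
(`heckeLFunction_hasEntireContinuation_of_not_isNormTwist_holds`) does not vanish at `s₀` — the tree's
conditional theorem `HeckeCharacter.hasEntireContinuation_continuation_ne_zero_of_re_eq_one`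
(`HeckeLFunctionNonvanishingLineProofs`: Landau's method at `s = 1` and the twist `χ ‖·‖^{it}`) fed with
the discharge for `χ` and for `χ⁻¹` (not a norm twist either, `HeckeCharacter.IsNormTwist.of_inv`).
In print: Iwasawa (1964), Prop. 4.4 ("`L(1 + iy; χ) ≠ 0`", by the `3, 4, 1` inequality).
[cite: Iwasawa2019, Ch. 4 §4.2 Prop. 4.4] -/
theorem heckeLFunction_continuation_ne_zero_of_re_eq_one {χ : HeckeCharacter K} (hχ : χ.IsUnitary)
    (hnt : ¬χ.IsNormTwist) {s₀ : ℂ} (hs₀ : s₀.re = 1) :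
    (heckeLFunction_hasEntireContinuation_of_not_isNormTwist_holds χ hχ hnt).continuation s₀ ≠ 0 :=
  HeckeCharacter.hasEntireContinuation_continuation_ne_zero_of_re_eq_one hχ _
    (heckeLFunction_hasEntireContinuation_of_not_isNormTwist_holds χ⁻¹ hχ.inv
      fun h => hnt (HeckeCharacter.IsNormTwist.of_inv h)) hs₀

end Literature.NumberTheory.GaloisRepresentations
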